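import Summits.ResolutionOfSingularities.ResolutionOfSingularities.Theorems.EquisingularLiftEquisingularLiftNatBlowupChartPointInjective
import Summits.ResolutionOfSingularities.ResolutionOfSingularities.Theorems.EquisingularLiftEquisingularLiftNatClusterPointDictA
import Literature.AlgebraicGeometry.Resolution.BlowupAlgebraQuasiRegularChart
import Summits.ResolutionOfSingularities.ResolutionOfSingularities.Theorems.MarkedTransferCampaignW46CuspStaircaseClosedPoint
import HarnessLib

/-!
# [OURS · L1 W4.5(b) · EL♮(3)] (δ) D3 POINT-DICT, part 1 (D3a′ + closedness): the CLUSTER POINTS of the exceptional divisor — the point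
# of the blowing up of a closed point `x` with PRESCRIBED AFFINE COORDINATES on a chart of a frame of `𝔪_x` is CLOSED and UNIQUE
# (over res-D-pv-051's existence + presentation …NatClusterPointDictA, p550366)

Crux chain w45b (cell `res-hironaka`, slot W4.5(b)), working crux **EL♮** = stmt-ResolutionOfSingularities-20038, child **EL♮(3)** =
stmt-ResolutionOfSingularities-20148, route EquisingularLift, line `sections`, registered stub `stub_elnat_tcPlusPlusPointResolution`
(v2); brick **(δ) D3 POINT-DICT** of res-L1-w45b-stub-3's `DELTA-PLAN.md` (TC⁺⁺ STEP 0 per subset), res-L1-w45b-plan-1 BOOKING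
2026-08-27T16:20:41Z / res-type-100 TAKING 17:01:37Z. HONEST FRAMING: OURS; NOT a statement of any manuscript; AI-written, weaker
than expert review. No `sorry`; standard axioms. DEF-FREE. `--supports stmt-ResolutionOfSingularities-20148 --as helper`.

WHY. The members of the TC⁺⁺ invariant `TCPlusPlus.Inv` (p547095) are indexed by subsets `S` of the untracked candidate centres
`Cand F₂ Z₂ ∅` — closed non-regular points of the reduced carrier curve `Z₂ ⊂ υ⁻¹{x} ≅ ℙ²`; the ring-side bricks (res-L1-w45b-stub-3's
D1 `exists_clusterConeLift_subset`, p548257) index them by the points `t` of the FAT CLUSTER of `CarrierCluster₂`: a chart `i t`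
of the frame `c̄` of `𝔪_x` and affine coordinates `a t : {l // l ≠ i t} → k'`. This file is the dictionary «coordinates ↦ point of
`F₂`»: for a frame `c̄` of `𝔪_x` (quasi-regular, e.g. `x` a regular point), a chart `j` and LIFTED coordinates `ã : {l // l ≠ j} →
𝒪_{F₁,x}`, THE point `y′ ∈ υ⁻¹{x}` with `c̄_l/c̄_j ≡ ã_l` — it exists, is CLOSED, comes with a chart-`j` presentation of `𝒪_{F₂,y′}`
in res-type-100's T-FRAME-AT shape (p527425; origin translated to `ã`), and is unique.

WHAT (namespace `…Cruxes.EquisingularLiftNat.Sections`; `R` local, `c : Fin k → R`, chart `j`, `B = R[(c)/c_j]`):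
* `eval_sub_algebraMap_eval_mem` / `eval_mem_iff_of_forall_frac_sub_mem` / `chartPrime_eq_of_forall_frac_sub_mem` — res-L1-w45b-stub-2's
  vertex-prime lemmas (…NatBlowupChartPointInjective §3) TRANSLATED to the point `ã`: for an ideal `𝔔 ∋ c_l/c_j − ã_l` (`l ≠ j`),
  `h(c/c_j) ≡ h(ã) mod 𝔔`; over `𝔪_R`, `h(c/c_j) ∈ 𝔔 ↔ h(ã) ∈ 𝔪_R`; two such ideals over `𝔪_R` are equal.
* closedness by res-L1-s46-pv-5's `CampaignW46.Cusp.isClosed_singleton_of_residueFieldMap_surjective` (Stacks 01TB packaged: a point over a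
  closed point of a Jacobson scheme with no residue field extension is closed; imported).
* `residueFieldMap_surjective_of_forall_frac_sub_mem` — a point presented on a chart at a prime containing all `c_l/c_j − ã_l` has no
  residue field extension over `x`.
* **`eq_of_chartPresentation_of_forall_frac_sub_mem`** (D3a′) — two points over `x` presented on the chart `j` with the same coordinates
  `ã` coincide (res-L1-w45b-stub-2 `eq_of_chartPresentation_of_prime_eq`).
* **`exists_clusterPoint`** (D3a) — res-D-pv-051's `exists_clusterPoint_presentation` (…NatClusterPointDictA p550366: the point `y′` of the
  maximal chart prime `𝔮 = (𝔪_x, c̄_l/c̄_jj − w_l)` with its presentation) PLUS `IsClosed {y′}` and the T-FRAME-AT spelling of `χ`.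

References: res-L1-w45b-stub-2 T-PTPRIME-DICT (…NatBlowupChartPointOfPrime p526020, …NatBlowupChartPointInjective p540294); res-type-100
T-FRAME-AT (…NatCarrierDeltaFrameAdapted p527425); The Stacks Project, Tags 0804, 052P, 0BIQ, 01TB [cite: StacksProject, Tag 0804].
-/

set_option linter.dupNamespace false -- mandated namespace `Summit.<Summit>.<Problem>` of this single-conjunct summit

noncomputable section

open CategoryTheory CategoryTheory.Limits AlgebraicGeometry TopologicalSpace IsLocalRing
open Literature.AlgebraicGeometry.Resolution
open AlgebraicGeometry.Scheme.IdealSheafData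

namespace Summit.ResolutionOfSingularities.ResolutionOfSingularities.Cruxes.EquisingularLiftNat.Sections

universe u

/-! ## 1. The translated vertex prime of a chart -/

section Ring

variable {R : Type u} [CommRing R] [IsLocalRing R] {k : ℕ} (c : Fin k → R) (j : Fin k)

omit [IsLocalRing R] in
/-- **Congruence to the value at `ã`.** If an ideal `𝔔` of `R[I/c_j]`, `I = (c)`, contains `c_l/c_j − ã_l` for every `l ≠ j`, then
`h(c/c_j) ≡ h(ã) mod 𝔔` for every `h ∈ R[T_l : l ≠ j]` (the two ring maps `R[T] → R[I/c_j]/𝔔` agree on `R` and on the `T_l`).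
[cite: StacksProject, Tag 052P] -/
theorem eval_sub_algebraMap_eval_mem (𝔔 : Ideal (blowupAlgebra (Ideal.span (Set.range c)) (c j)))
    (a : {l : Fin k // l ≠ j} → R)
    (hfr : ∀ l : {l : Fin k // l ≠ j}, blowupAlgebra.frac c j l.1 - algebraMap R _ (a l) ∈ 𝔔)
    (h : MvPolynomial {l : Fin k // l ≠ j} R) :
    blowupAlgebra.eval c j h - algebraMap R _ (MvPolynomial.eval a h) ∈ 𝔔 := by
  have hagree : (Ideal.Quotient.mk 𝔔).comp (blowupAlgebra.eval c j).toRingHom =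
      ((Ideal.Quotient.mk 𝔔).comp (algebraMap R (blowupAlgebra (Ideal.span (Set.range c)) (c j)))).comp
        (MvPolynomial.eval a) := by
    refine MvPolynomial.ringHom_ext (fun r => ?_) (fun l => ?_)
    · simp only [RingHom.comp_apply, AlgHom.toRingHom_eq_coe, RingHom.coe_coe, blowupAlgebra.eval_C,
        MvPolynomial.eval_C]
    · simp only [RingHom.comp_apply, AlgHom.toRingHom_eq_coe, RingHom.coe_coe, blowupAlgebra.eval_X,
        MvPolynomial.eval_X]
      exact (Ideal.Quotient.eq).mpr (hfr l)
  have hh := RingHom.congr_fun hagree h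
  simp only [RingHom.comp_apply, AlgHom.toRingHom_eq_coe, RingHom.coe_coe] at hh
  exact (Ideal.Quotient.eq).mp hh

/-- **Membership in a translated vertex prime is read on the value at `ã`.** For `𝔔` over `𝔪_R` containing every `c_l/c_j − ã_l`:
`h(c/c_j) ∈ 𝔔 ↔ h(ã) ∈ 𝔪_R`. [cite: StacksProject, Tag 052P] -/
theorem eval_mem_iff_of_forall_frac_sub_mem (𝔔 : Ideal (blowupAlgebra (Ideal.span (Set.range c)) (c j)))
    (h𝔔 : 𝔔.comap (algebraMap R (blowupAlgebra (Ideal.span (Set.range c)) (c j))) = maximalIdeal R)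
    (a : {l : Fin k // l ≠ j} → R)
    (hfr : ∀ l : {l : Fin k // l ≠ j}, blowupAlgebra.frac c j l.1 - algebraMap R _ (a l) ∈ 𝔔)
    (h : MvPolynomial {l : Fin k // l ≠ j} R) :
    blowupAlgebra.eval c j h ∈ 𝔔 ↔ MvPolynomial.eval a h ∈ maximalIdeal R := by
  have hsub := eval_sub_algebraMap_eval_mem c j 𝔔 a hfr h
  rw [← h𝔔, Ideal.mem_comap]
  constructor
  · intro hm
    have := 𝔔.sub_mem hm hsub
    rwa [sub_sub_cancel] at this
  · intro hm
    have := 𝔔.add_mem hsub hm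
    rwa [sub_add_cancel] at this

/-- **The translated vertex prime is unique**: two ideals of `R[I/c_j]` over `𝔪_R` containing every `c_l/c_j − ã_l`, `l ≠ j`, are equal
(tree `blowupAlgebra.eval_surjective`). [cite: StacksProject, Tag 052P] -/
theorem chartPrime_eq_of_forall_frac_sub_mem (𝔔₁ 𝔔₂ : Ideal (blowupAlgebra (Ideal.span (Set.range c)) (c j)))
    (h𝔔₁ : 𝔔₁.comap (algebraMap R (blowupAlgebra (Ideal.span (Set.range c)) (c j))) = maximalIdeal R)
    (h𝔔₂ : 𝔔₂.comap (algebraMap R (blowupAlgebra (Ideal.span (Set.range c)) (c j))) = maximalIdeal R)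
    (a : {l : Fin k // l ≠ j} → R)
    (hfr₁ : ∀ l : {l : Fin k // l ≠ j}, blowupAlgebra.frac c j l.1 - algebraMap R _ (a l) ∈ 𝔔₁)
    (hfr₂ : ∀ l : {l : Fin k // l ≠ j}, blowupAlgebra.frac c j l.1 - algebraMap R _ (a l) ∈ 𝔔₂) : 𝔔₁ = 𝔔₂ := by
  ext b
  obtain ⟨h, rfl⟩ := blowupAlgebra.eval_surjective c j b
  rw [eval_mem_iff_of_forall_frac_sub_mem c j 𝔔₁ h𝔔₁ a hfr₁, eval_mem_iff_of_forall_frac_sub_mem c j 𝔔₂ h𝔔₂ a hfr₂]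

end Ring

/-! ## 2. The residue field of a coordinate point -/

variable {F₁ F₂ : Scheme.{u}} {υ : F₂ ⟶ F₁}

/-- **A coordinate point has no residue field extension.** If `𝒪_{F₂,y′}` is presented on the chart `c̄_j` of `𝒪_{F₁,υ y′}[𝔪/c̄_j]`
at a prime `𝔔` over `𝔪` containing every `c̄_l/c̄_j − ã_l`, then `κ(υ y′) → κ(y′)` is onto: every element of `𝒪_{F₂,y′}` is
`χ h(c̄/c̄_j) / χ u(c̄/c̄_j)` with `u(ã) ∉ 𝔪`, congruent to `υ♯(h(ã) u(ã)⁻¹)` modulo `𝔪_{y′}`. [cite: StacksProject, Tag 052P] -/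
theorem residueFieldMap_surjective_of_forall_frac_sub_mem (y' : F₂) {k : ℕ}
    (c : Fin k → F₁.presheaf.stalk (υ y')) (j : Fin k)
    (𝔔 : PrimeSpectrum (blowupAlgebra (Ideal.span (Set.range c)) (c j)))
    (χ : blowupAlgebra (Ideal.span (Set.range c)) (c j) →+* F₂.presheaf.stalk y')
    (hχ : ∀ r, χ (algebraMap _ _ r) = (υ.stalkMap y').hom r)
    (hloc : @IsLocalization.AtPrime _ _ (F₂.presheaf.stalk y') _ χ.toAlgebra 𝔔.asIdeal _)
    (h𝔔 : 𝔔.asIdeal.comap (algebraMap _ (blowupAlgebra (Ideal.span (Set.range c)) (c j))) =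
      maximalIdeal (F₁.presheaf.stalk (υ y')))
    (a : {l : Fin k // l ≠ j} → F₁.presheaf.stalk (υ y'))
    (hfr : ∀ l : {l : Fin k // l ≠ j}, blowupAlgebra.frac c j l.1 - algebraMap _ _ (a l) ∈ 𝔔.asIdeal) :
    Function.Surjective (υ.residueFieldMap y') := by
  classical
  letI := χ.toAlgebra
  haveI : IsLocalization.AtPrime (F₂.presheaf.stalk y') 𝔔.asIdeal := hloc
  have hχ𝔪 : ∀ b, b ∈ 𝔔.asIdeal ↔ χ b ∈ maximalIdeal (F₂.presheaf.stalk y') :=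
    fun b => mem_chartPrime_iff_apply_mem_maximalIdeal 𝔔 χ hloc b
  -- the residue of `χ (h(c̄/c̄_j))` is the residue of `υ♯ h(ã)`
  have hres : ∀ h : MvPolynomial {l : Fin k // l ≠ j} (F₁.presheaf.stalk (υ y')),
      (F₂.residue y') (χ (blowupAlgebra.eval c j h)) =
        (υ.residueFieldMap y') ((F₁.residue (υ y')) (MvPolynomial.eval a h)) := by
    intro h
    rw [← CommRingCat.comp_apply, Scheme.residue_residueFieldMap, CommRingCat.comp_apply, ← hχ]
    have hm : χ (blowupAlgebra.eval c j h) - χ (algebraMap _ _ (MvPolynomial.eval a h)) ∈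
        maximalIdeal (F₂.presheaf.stalk y') := by
      rw [← map_sub]; exact (hχ𝔪 _).mp (eval_sub_algebraMap_eval_mem c j 𝔔.asIdeal a hfr h)
    change IsLocalRing.residue _ _ = IsLocalRing.residue _ _
    rw [← sub_eq_zero, ← map_sub, IsLocalRing.residue_eq_zero_iff]
    exact hm
  intro r
  obtain ⟨z, rfl⟩ := F₂.residue_surjective y' r
  obtain ⟨⟨b, u⟩, hz⟩ := IsLocalization.surj 𝔔.asIdeal.primeCompl z
  obtain ⟨hb, rfl⟩ := blowupAlgebra.eval_surjective c j b
  obtain ⟨hu, hhu⟩ := blowupAlgebra.eval_surjective c j (u : blowupAlgebra (Ideal.span (Set.range c)) (c j))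
  -- `u(ã)` is a unit of `𝒪_{F₁,υ y′}`
  have hua : MvPolynomial.eval a hu ∉ maximalIdeal (F₁.presheaf.stalk (υ y')) := by
    intro hm
    apply u.2
    rw [← hhu]
    exact (eval_mem_iff_of_forall_frac_sub_mem c j 𝔔.asIdeal h𝔔 a hfr hu).mpr hm
  have hunit : IsUnit (MvPolynomial.eval a hu) := by
    by_contra hnu
    exact hua ((mem_maximalIdeal _).mpr hnu)
  refine ⟨(F₁.residue (υ y')) (MvPolynomial.eval a hb * ↑hunit.unit⁻¹), ?_⟩
  -- `residue z · residue (χ u) = residue (χ b)` and `residue (χ u) = residueFieldMap (residue u(ã)) ≠ 0`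
  have hz' : (F₂.residue y') z * (F₂.residue y') (χ (blowupAlgebra.eval c j hu)) =
      (F₂.residue y') (χ (blowupAlgebra.eval c j hb)) := by
    rw [← map_mul, hhu]; exact congrArg _ hz
  rw [hres hu, hres hb] at hz'
  have hune : (υ.residueFieldMap y') ((F₁.residue (υ y')) (MvPolynomial.eval a hu)) ≠ 0 := by
    rw [← hres hu, hhu]
    change IsLocalRing.residue _ _ ≠ 0
    rw [Ne, IsLocalRing.residue_eq_zero_iff]
    exact fun hm => u.2 ((hχ𝔪 _).mpr hm)
  rw [map_mul, map_mul]
  have hinv : (υ.residueFieldMap y') ((F₁.residue (υ y')) ↑hunit.unit⁻¹) *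
      (υ.residueFieldMap y') ((F₁.residue (υ y')) (MvPolynomial.eval a hu)) = 1 := by
    rw [← map_mul, ← map_mul, IsUnit.val_inv_mul, map_one, map_one]
  calc (υ.residueFieldMap y') ((F₁.residue (υ y')) (MvPolynomial.eval a hb)) *
        (υ.residueFieldMap y') ((F₁.residue (υ y')) ↑hunit.unit⁻¹)
      = (F₂.residue y') z * (υ.residueFieldMap y') ((F₁.residue (υ y')) (MvPolynomial.eval a hu)) *
          (υ.residueFieldMap y') ((F₁.residue (υ y')) ↑hunit.unit⁻¹) := by rw [hz']
    _ = (F₂.residue y') z := by rw [mul_assoc, mul_comm _ ((υ.residueFieldMap y') _), hinv, mul_one]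

/-! ## 3. (D3a′) Uniqueness and (D3a) existence of the coordinate point -/

/-- **(D3a′) A point of the blowing up is determined by its chart and its coordinates.** Two points `z₁, z₂` over `x`, each
presented on the chart `c̄_j` (`c̄` any family in `𝒪_{F₁,x}`, e.g. a frame of the centre's stalk) at a prime over `𝔪_x` containing
every `c̄_l/c̄_j − ã_l`, coincide: the primes agree (`chartPrime_eq_of_forall_frac_sub_mem`), then res-L1-w45b-stub-2's
`eq_of_chartPresentation_of_prime_eq`. [cite: StacksProject, Tag 0804] -/
theorem eq_of_chartPresentation_of_forall_frac_sub_mem {J : F₁.IdealSheafData} (hυ : IsBlowup υ J) {z₁ z₂ : F₂}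
    {x : F₁} (h₁ : υ z₁ = x) (h₂ : υ z₂ = x) {k : ℕ} (c : Fin k → F₁.presheaf.stalk x) (j : Fin k)
    (𝔔₁ 𝔔₂ : PrimeSpectrum (blowupAlgebra (Ideal.span (Set.range c)) (c j)))
    (χ₁ : blowupAlgebra (Ideal.span (Set.range c)) (c j) →+* F₂.presheaf.stalk z₁)
    (χ₂ : blowupAlgebra (Ideal.span (Set.range c)) (c j) →+* F₂.presheaf.stalk z₂)
    (hχ₁ : ∀ r, χ₁ (algebraMap _ _ r) = ((F₁.presheaf.stalkCongr (.of_eq h₁)).inv ≫ υ.stalkMap z₁).hom r)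
    (hχ₂ : ∀ r, χ₂ (algebraMap _ _ r) = ((F₁.presheaf.stalkCongr (.of_eq h₂)).inv ≫ υ.stalkMap z₂).hom r)
    (hloc₁ : @IsLocalization.AtPrime _ _ (F₂.presheaf.stalk z₁) _ χ₁.toAlgebra 𝔔₁.asIdeal _)
    (hloc₂ : @IsLocalization.AtPrime _ _ (F₂.presheaf.stalk z₂) _ χ₂.toAlgebra 𝔔₂.asIdeal _)
    (h𝔔₁ : 𝔔₁.asIdeal.comap (algebraMap _ (blowupAlgebra (Ideal.span (Set.range c)) (c j))) =
      maximalIdeal (F₁.presheaf.stalk x))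
    (h𝔔₂ : 𝔔₂.asIdeal.comap (algebraMap _ (blowupAlgebra (Ideal.span (Set.range c)) (c j))) =
      maximalIdeal (F₁.presheaf.stalk x))
    (a : {l : Fin k // l ≠ j} → F₁.presheaf.stalk x)
    (hfr₁ : ∀ l : {l : Fin k // l ≠ j}, blowupAlgebra.frac c j l.1 - algebraMap _ _ (a l) ∈ 𝔔₁.asIdeal)
    (hfr₂ : ∀ l : {l : Fin k // l ≠ j}, blowupAlgebra.frac c j l.1 - algebraMap _ _ (a l) ∈ 𝔔₂.asIdeal) :
    z₁ = z₂ := by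
  have h𝔔 : 𝔔₁ = 𝔔₂ :=
    PrimeSpectrum.ext (chartPrime_eq_of_forall_frac_sub_mem c j 𝔔₁.asIdeal 𝔔₂.asIdeal h𝔔₁ h𝔔₂ a hfr₁ hfr₂)
  subst h𝔔
  exact eq_of_chartPresentation_of_prime_eq hυ h₁ h₂ c j 𝔔₁ χ₁ χ₂ hχ₁ hχ₂ hloc₁ hloc₂

set_option maxHeartbeats 400000 in -- the chart algebra `blowupAlgebra` is a subalgebra of a localisation: slow instance unification (cf. p527425)
/-- **(D3a) THE CLUSTER POINT `y′_t` of the exceptional divisor, CLOSED, with its chart presentation** — res-D-pv-051's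
`exists_clusterPoint_presentation` (…NatClusterPointDictA, p550366) COMPLETED by the closedness of `y′` and re-keyed to res-type-100's
T-FRAME-AT shape (`χ ∘ (·/1) = (stalkCongr hy′)⁻¹ ≫ υ♯_{y′}`). Data: `υ : F₂ → F₁` the blowing up of the CLOSED point `x` of the Jacobson
scheme `F₁` (e.g. locally of finite type over a field), `υ` locally of finite type, `c̄ : Fin 3 → 𝒪_{F₁,x}` a QUASI-REGULAR frame with residue
model `πk : 𝒪_{F₁,x} ↠ k'`, `ker πk = (c̄)` (`CarrierCluster₂`'s currency), a chart `jj`, affine coordinates `a : {l // l ≠ jj} → k'` with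
lifts `w`. Conclusion: a point `y′ ∈ F₂`, `υ y′ = x`, **`{y′}` closed** (no residue field extension, `residueFieldMap_surjective_of_forall_frac_sub_mem`,
then Stacks 01TB via res-L1-s46-pv-5's lemma), presented on the chart `c̄_jj` at the maximal prime `𝔮 ∋ c̄_l/c̄_jj − w_l` over `𝔪_x`:
**`y′` is the point with affine coordinates `a` on the chart `c̄_jj ≠ 0` of `υ⁻¹{x} ≅ ℙ²_{k'}`.** [cite: StacksProject, Tag 0804; StacksProject, Tag 01TB] -/
theorem exists_clusterPoint {F₁ F₂ : Scheme.{0}} {υ : F₂ ⟶ F₁} [LocallyOfFiniteType υ] [JacobsonSpace F₁] {x : F₁}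
    (hx : IsClosed ({x} : Set F₁)) (hυ : IsBlowup υ (vanishingIdeal (⟨{x}, hx⟩ : Closeds F₁)))
    (c : Fin 3 → F₁.presheaf.stalk x) (hc : IsQuasiRegular c) {k' : Type} [Field k'] (πk : F₁.presheaf.stalk x →+* k')
    (hπk : Function.Surjective πk) (hker : RingHom.ker πk = Ideal.span (Set.range c)) (jj : Fin 3)
    (a : {l : Fin 3 // l ≠ jj} → k') (w : {l : Fin 3 // l ≠ jj} → F₁.presheaf.stalk x) (hw : ∀ l, πk (w l) = a l) :
    ∃ (y' : F₂) (hy' : υ y' = x), IsClosed ({y'} : Set F₂) ∧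
      ∃ (𝔮 : PrimeSpectrum (blowupAlgebra (Ideal.span (Set.range c)) (c jj)))
        (χ : blowupAlgebra (Ideal.span (Set.range c)) (c jj) →+* F₂.presheaf.stalk y')
        (e : F₂.presheaf.stalk y' ≃+* Localization.AtPrime 𝔮.asIdeal),
        (∀ r, χ (algebraMap _ _ r) = ((F₁.presheaf.stalkCongr (.of_eq hy')).inv ≫ υ.stalkMap y').hom r) ∧
        @IsLocalization.AtPrime _ _ (F₂.presheaf.stalk y') _ χ.toAlgebra 𝔮.asIdeal _ ∧
        (∀ b, e (χ b) = algebraMap _ (Localization.AtPrime 𝔮.asIdeal) b) ∧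
        𝔮.asIdeal.comap (algebraMap _ (blowupAlgebra (Ideal.span (Set.range c)) (c jj))) =
          maximalIdeal (F₁.presheaf.stalk x) ∧
        𝔮.asIdeal.IsMaximal ∧
        ∀ l : {l : Fin 3 // l ≠ jj}, blowupAlgebra.frac c jj l.1 - algebraMap _ _ (w l) ∈ 𝔮.asIdeal := by
  classical
  obtain ⟨𝔮, y', hy', χ, e, hχ, hloc, he, h𝔮, hmax, hfr⟩ :=
    exists_clusterPoint_presentation hx hυ c hc πk hπk hker jj a w hw
  subst hy'
  -- the structure map read through `stalkCongr` of `rfl` is `υ♯_{y′}` itself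
  have hχ' : ∀ r, χ (algebraMap _ _ r) = (υ.stalkMap y').hom r := fun r => by
    rw [hχ r, TopCat.Presheaf.stalkCongr_hom]
    congr 1
    exact stalkSpecializes_self_apply F₁.presheaf (υ y') _ r
  have hχ'' : ∀ r, χ (algebraMap _ _ r) =
      ((F₁.presheaf.stalkCongr (.of_eq (rfl : υ y' = υ y'))).inv ≫ υ.stalkMap y').hom r := fun r => by
    rw [hχ' r, CommRingCat.comp_apply, TopCat.Presheaf.stalkCongr_inv]
    congr 1
    exact (stalkSpecializes_self_apply F₁.presheaf (υ y') _ r).symm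
  refine ⟨y', rfl, ?_, 𝔮, χ, e, hχ'', hloc, he, h𝔮, hmax, hfr⟩
  exact Summit.ResolutionOfSingularities.ResolutionOfSingularities.Theorems.CampaignW46.Cusp.isClosed_singleton_of_residueFieldMap_surjective
    υ hx (residueFieldMap_surjective_of_forall_frac_sub_mem y' c jj 𝔮 χ hχ' hloc h𝔮 w hfr)

end Summit.ResolutionOfSingularities.ResolutionOfSingularities.Cruxes.EquisingularLiftNat.Sections

end
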